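import Literature.MathematicalPhysics.QuantumLattice.QuasiLocalAverageProofs
import Mathlib.MeasureTheory.Integral.DominatedConvergence
import HarnessLib

/-!
# Analytic properties of the Hastings generator `s ↦ ∫ w(t) • τ_t^{H₀+sX}(Y) dt`

Sixteenth file of the formalisation of the Michalakis–Zwolak stability theorem (hubbard.S19).
The quasi-adiabatic generator `D(s) = ∫ W(t) e^{itH_s} X e^{−itH_s} dt`, `H_s = H₀ + sX`
(Michalakis–Zwolak, arXiv:1109.1588 §5.2; Bachmann–Michalakis–Nachtergaele–Sims,
arXiv:1102.0842 §2 eq. (2.13)) and its twirl-localised pieces enter the unitary flow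
(`exists_unitary_flow`, `exists_unitary_propagator`) and the flow Lieb–Robinson bounds
(`FlowLiebRobinsonProofs`, `FlowQuasiLocalityProofs`), which require the generator to be
continuous in `s`, uniformly bounded and Hermitian:

* `conjTranspose_integral`, `isHermitian_integral_smul_heisenbergEvolution` — Hermiticity for a
  real weight and Hermitian `H`, `Y`;
* `continuous_integral_smul_heisenbergEvolution_affine` (dominated convergence) and its twirled
  version `continuous_twirl_integral_smul_heisenbergEvolution_affine`;
* `norm_integral_smul_heisenbergEvolution_affine_le` — the bound `‖w‖₁ ‖Y‖`, uniform in `s`.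

No definitions, no named facts (theorems only). [folklore]
-/

noncomputable section

open Matrix Complex NormedSpace MeasureTheory Finset Filter
open scoped Matrix.Norms.L2Operator Topology

namespace Literature.MathematicalPhysics.QuantumLattice

variable {n : Type*} [Fintype n] [DecidableEq n]

/-! ### Conjugate transposition under the Bochner integral -/

/-- Conjugate transposition commutes with the Bochner integral (it is a continuous `ℝ`-linear
map). [folklore] -/
theorem conjTranspose_integral {f : ℝ → Matrix n n ℂ} (hf : Integrable f) :
    (∫ t : ℝ, f t)ᴴ = ∫ t : ℝ, (f t)ᴴ := by
  let L : Matrix n n ℂ →ₗ[ℝ] Matrix n n ℂ :=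
    { toFun := fun M => Mᴴ
      map_add' := fun M N => Matrix.conjTranspose_add M N
      map_smul' := fun c M => by
        ext i j
        simp [Matrix.conjTranspose_apply, Matrix.smul_apply] }
  have h := ContinuousLinearMap.integral_comp_comm (LinearMap.toContinuousLinearMap L) hf
  exact h.symm

/-- **The smoothed observable of a Hermitian observable with a real weight is Hermitian**:
`(∫ w(t) • τ_t(Y) dt)ᴴ = ∫ w(t) • τ_t(Y) dt` when `conj w = w`, `Yᴴ = Y`, `Hᴴ = H`
(so the Hastings generator `D(s)` is Hermitian; BMNS 2011 §2, MZ13 §5.2). [folklore] -/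
theorem isHermitian_integral_smul_heisenbergEvolution {H Y : Matrix n n ℂ} (hH : H.IsHermitian)
    (hY : Y.IsHermitian) {w : ℝ → ℂ} (hw : Integrable w) (hwr : ∀ t, starRingEnd ℂ (w t) = w t) :
    (∫ t : ℝ, w t • heisenbergEvolution H t Y).IsHermitian := by
  rw [IsHermitian, conjTranspose_integral (integrable_smul_heisenbergEvolution hH hw Y)]
  refine integral_congr_ae (Eventually.of_forall fun t => ?_)
  simp only
  rw [conjTranspose_smul, heisenbergEvolution_conjTranspose hH, hY.eq]
  congr 1
  exact hwr t

/-! ### Continuity of the generator along the affine path -/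

/-- The Heisenberg evolution depends continuously on the coupling: for fixed `t`, `Y`,
`s ↦ τ_t^{H₀ + sX}(Y)` is continuous. [folklore] -/
theorem continuous_heisenbergEvolution_affine (H₀ X Y : Matrix n n ℂ) (t : ℝ) :
    Continuous fun s : ℝ => heisenbergEvolution (H₀ + s • X) t Y := by
  letI : NormedAlgebra ℚ (Matrix n n ℂ) := .restrictScalars ℚ ℂ _
  unfold heisenbergEvolution
  fun_prop

/-- **Continuity of the Hastings generator in the coupling**: for an integrable weight `w`,
Hermitian `H₀`, `X` and any `Y`, `s ↦ ∫ w(t) • τ_t^{H₀ + sX}(Y) dt` is continuous (dominated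
convergence with the bound `|w(t)| ‖Y‖`). [folklore] -/
theorem continuous_integral_smul_heisenbergEvolution_affine {H₀ X : Matrix n n ℂ}
    (hH₀ : H₀.IsHermitian) (hX : X.IsHermitian) {w : ℝ → ℂ} (hw : Integrable w) (Y : Matrix n n ℂ) :
    Continuous fun s : ℝ => ∫ t : ℝ, w t • heisenbergEvolution (H₀ + s • X) t Y := by
  have hHs : ∀ s : ℝ, (H₀ + s • X).IsHermitian := fun s =>
    hH₀.add (hX.smul (IsSelfAdjoint.all s))
  refine continuous_of_dominated (bound := fun t => ‖w t‖ * ‖Y‖) (fun s => ?_) (fun s => ?_)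
    (hw.norm.mul_const ‖Y‖) ?_
  · exact (integrable_smul_heisenbergEvolution (hHs s) hw Y).aestronglyMeasurable
  · refine Eventually.of_forall fun t => ?_
    rw [norm_smul, norm_heisenbergEvolution_holds (hHs s)]
  · refine Eventually.of_forall fun t => ?_
    exact (continuous_heisenbergEvolution_affine H₀ X Y t).const_smul (w t)

/-- The twirled pieces of the generator are continuous in the coupling as well (the twirl is a
continuous linear map). [folklore] -/
theorem continuous_twirl_integral_smul_heisenbergEvolution_affine {Λ : Type*} [Fintype Λ]
    [DecidableEq Λ] {q : ℕ} (S : Finset Λ) {H₀ X : Op Λ q} (hH₀ : H₀.IsHermitian)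
    (hX : X.IsHermitian) {w : ℝ → ℂ} (hw : Integrable w) (Y : Op Λ q) :
    Continuous fun s : ℝ => twirl S (∫ t : ℝ, w t • heisenbergEvolution (H₀ + s • X) t Y) := by
  let L : Op Λ q →ₗ[ℂ] Op Λ q :=
    { toFun := fun N => twirl S N, map_add' := twirl_add S, map_smul' := fun c N => twirl_smul S c N }
  have hL : Continuous fun N : Op Λ q => twirl S N := (LinearMap.toContinuousLinearMap L).continuous
  exact hL.comp (continuous_integral_smul_heisenbergEvolution_affine hH₀ hX hw Y)

/-- **Uniform bound of the generator**: `‖∫ w(t) • τ_t^{H₀+sX}(Y) dt‖ ≤ ‖w‖₁ ‖Y‖` for every `s`.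
[folklore] -/
theorem norm_integral_smul_heisenbergEvolution_affine_le {H₀ X : Matrix n n ℂ}
    (hH₀ : H₀.IsHermitian) (hX : X.IsHermitian) (w : ℝ → ℂ) (Y : Matrix n n ℂ) (s : ℝ) :
    ‖∫ t : ℝ, w t • heisenbergEvolution (H₀ + s • X) t Y‖ ≤ (∫ t : ℝ, ‖w t‖) * ‖Y‖ :=
  norm_integral_smul_heisenbergEvolution_le (hH₀.add (hX.smul (IsSelfAdjoint.all s))) w Y

end Literature.MathematicalPhysics.QuantumLattice
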